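import Summits.RiemannHypothesis.RiemannHypothesis.Theses.WeilComb
import Literature.NumberTheory.LFunctions.WeilExplicit
import Literature.NumberTheory.LFunctions.MontgomeryOffDiagonalTools
import Literature.NumberTheory.LFunctions.SchoenfeldPsiSmall
import Literature.NumberTheory.LFunctions.ChebyshevSylvesterPsi
import Mathlib.NumberTheory.Chebyshev

/-!
# Stub `stub_poincareEta` of line `Sketch` for crux `WeilComb.CombShapePositivity`
(item stmt-RiemannHypothesis-11229, route route-RiemannHypothesis-WeilComb)

The multiscale Hardy/Poincaré inequality on the von Mangoldt divisor graph (edges `m → nm`,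
`n` a prime power, Perron gauge `n^{-1/2}`) with a free splitting parameter `η > 0` and the
tree's explicit Chebyshev constant `23/20`:

`Σ_{k ≤ M} k · log k · ‖a_k‖² ≤ (1 + η) M · D(a) + (1 + 1/η) (23/20) · M · Σ_{m ≤ M} ‖a_m‖²`,
`D(a) = Σ_{m ≤ M} Σ_{n ≤ M/m} Λ(n) ‖a(nm) − n^{-1/2} a(m)‖²`.

Proof (same skeleton as `stub_poincare_explicit`, `Theorems/WeilCombCombShapePositivityStubPoincareExplicit.lean`):
write `log k = Σ_{n ∣ k} Λ(n)` (`ArithmeticFunction.vonMangoldt_sum`) and reindex the pairs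
`(k, n)`, `k ≤ M`, `n ∣ k` by `(m, n) = (k/n, n)`, `m ≤ M`, `n ≤ M/m`, so that
`Σ_k k log k ‖a_k‖² = Σ_m Σ_{n ≤ M/m} Λ(n) (nm) ‖a(nm)‖²`. Along each edge,
`‖a(nm)‖² ≤ (1 + η) ‖a(nm) − n^{-1/2} a(m)‖² + (1 + 1/η) ‖a(m)‖² / n` (from
`2 ‖x − y‖ ‖y‖ ≤ η ‖x − y‖² + η⁻¹ ‖y‖²`) and `nm ≤ M`, whence
`Λ(n) (nm) ‖a(nm)‖² ≤ (1 + η) M Λ(n) ‖a(nm) − n^{-1/2} a(m)‖² + (1 + 1/η) m Λ(n) ‖a(m)‖²`.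
Summing, the first part is `(1 + η) M · D(a)` and the second is
`(1 + 1/η) Σ_m m ‖a_m‖² ψ(M/m) ≤ (1 + 1/η) (23/20) Σ_m m (M/m) ‖a_m‖² ≤ (1 + 1/η)(23/20) M ‖a‖²`
by the explicit Chebyshev bound `ψ(K) ≤ (23/20) K` for every natural `K`: for `K ≤ 10⁴` this is
`SchoenfeldBound.psi_le_of_le_ten_thousand` (`ψ ≤ 1.04 x`), and for `K ≥ 10⁴` it is `psi_le_sylvester`
(`ψ(x) ≤ 1.0722 x + 7 √x`) together with `7 √K ≤ 0.07 K`.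
-/

noncomputable section

-- the sub-problem path RiemannHypothesis/RiemannHypothesis duplicates a namespace (D-0017)
set_option linter.dupNamespace false

open scoped BigOperators ComplexConjugate
open Complex MeasureTheory

namespace Summit.RiemannHypothesis.RiemannHypothesis.Theorems.WeilCombBohrFejer

open Literature.NumberTheory.LFunctions

-- adapted from Theorems/WeilCombCombShapePositivityStubPoincareExplicit.lean
/-- Reindexing the edges of the divisor graph by their endpoint: the pairs `(m, n)` with
`1 ≤ m ≤ M`, `1 ≤ n ≤ M/m` correspond to the pairs `(k, n)` with `1 ≤ k ≤ M`, `n ∣ k` via `k = nm`,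
so `Σ_{m ≤ M} Σ_{n ≤ M/m} F(n, m) = Σ_{k ≤ M} Σ_{n ∣ k} F(n, k/n)`. [folklore] -/
private theorem sum_Icc_sum_Icc_div_eq_sum_divisors_poincareEta (M : ℕ) (F : ℕ → ℕ → ℝ) :
    ∑ m ∈ Finset.Icc 1 M, ∑ n ∈ Finset.Icc 1 (M / m), F n m =
      ∑ k ∈ Finset.Icc 1 M, ∑ n ∈ k.divisors, F n (k / n) := by
  rw [Finset.sum_sigma', Finset.sum_sigma']
  refine Finset.sum_nbij' (fun x => ⟨x.2 * x.1, x.2⟩) (fun y => ⟨y.1 / y.2, y.2⟩) ?_ ?_ ?_ ?_ ?_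
  · rintro ⟨m, n⟩ hx
    simp only [Finset.mem_sigma, Finset.mem_Icc] at hx
    obtain ⟨⟨hm1, -⟩, hn1, hnM⟩ := hx
    have hnm : 0 < n * m := Nat.mul_pos hn1 hm1
    simp only [Finset.mem_sigma, Finset.mem_Icc, Nat.mem_divisors]
    exact ⟨⟨hnm, (Nat.le_div_iff_mul_le hm1).1 hnM⟩, dvd_mul_right n m, hnm.ne'⟩
  · rintro ⟨k, n⟩ hy
    simp only [Finset.mem_sigma, Finset.mem_Icc, Nat.mem_divisors] at hy
    obtain ⟨⟨hk1, hkM⟩, hnk, -⟩ := hy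
    have hn0 : 0 < n := Nat.pos_of_dvd_of_pos hnk hk1
    have hkn : 0 < k / n := Nat.div_pos (Nat.le_of_dvd hk1 hnk) hn0
    simp only [Finset.mem_sigma, Finset.mem_Icc]
    refine ⟨⟨hkn, (Nat.div_le_self k n).trans hkM⟩, hn0, (Nat.le_div_iff_mul_le hkn).2 ?_⟩
    rw [Nat.mul_div_cancel' hnk]
    exact hkM
  · rintro ⟨m, n⟩ hx
    simp only [Finset.mem_sigma, Finset.mem_Icc] at hx
    simp only [Nat.mul_div_cancel_left m hx.2.1]
  · rintro ⟨k, n⟩ hy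
    simp only [Finset.mem_sigma, Nat.mem_divisors] at hy
    simp only [Nat.mul_div_cancel' hy.2.1]
  · rintro ⟨m, n⟩ hx
    simp only [Finset.mem_sigma, Finset.mem_Icc] at hx
    simp only [Nat.mul_div_cancel_left m hx.2.1]

/-- The weighted parallelogram bound `‖x‖² ≤ (1 + η) ‖x − y‖² + (1 + 1/η) ‖y‖²` in `ℂ` for `η > 0`
(from `‖x‖ ≤ ‖x − y‖ + ‖y‖` and `2 ‖x − y‖ ‖y‖ ≤ η ‖x − y‖² + η⁻¹ ‖y‖²`). [folklore] -/
private theorem norm_sq_le_eta_mul_norm_sub_sq_add_poincareEta (x y : ℂ) {η : ℝ} (hη : 0 < η) :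
    ‖x‖ ^ 2 ≤ (1 + η) * ‖x - y‖ ^ 2 + (1 + 1 / η) * ‖y‖ ^ 2 := by
  have h : ‖x‖ ≤ ‖x - y‖ + ‖y‖ := by
    simpa only [sub_add_cancel] using norm_add_le (x - y) y
  have hsq : ‖x‖ ^ 2 ≤ (‖x - y‖ + ‖y‖) ^ 2 :=
    pow_le_pow_left₀ (norm_nonneg x) h 2
  have hkey : (η * ‖x - y‖ - ‖y‖) ^ 2 / η =
      η * ‖x - y‖ ^ 2 + ‖y‖ ^ 2 / η - 2 * ‖x - y‖ * ‖y‖ := by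
    field_simp
    ring
  have hamgm : 2 * ‖x - y‖ * ‖y‖ ≤ η * ‖x - y‖ ^ 2 + ‖y‖ ^ 2 / η := by
    have : 0 ≤ (η * ‖x - y‖ - ‖y‖) ^ 2 / η := by positivity
    linarith
  calc ‖x‖ ^ 2 ≤ (‖x - y‖ + ‖y‖) ^ 2 := hsq
    _ = ‖x - y‖ ^ 2 + 2 * ‖x - y‖ * ‖y‖ + ‖y‖ ^ 2 := by ring
    _ ≤ ‖x - y‖ ^ 2 + (η * ‖x - y‖ ^ 2 + ‖y‖ ^ 2 / η) + ‖y‖ ^ 2 := by linarith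
    _ = (1 + η) * ‖x - y‖ ^ 2 + (1 + 1 / η) * ‖y‖ ^ 2 := by ring

-- adapted from Theorems/WeilCombCombShapePositivityStubPoincareExplicit.lean (free parameter `η`)
/-- The bound along one edge `m → nm` (`1 ≤ n`, `nm ≤ M`) of the divisor graph:
`Λ(n) (nm) ‖a(nm)‖² ≤ (1 + η) M Λ(n) ‖a(nm) − n^{-1/2} a(m)‖² + (1 + 1/η) m Λ(n) ‖a(m)‖²`. [folklore] -/
private theorem vonMangoldt_mul_mul_norm_sq_le_poincareEta (a : ℕ → ℂ) {M m n : ℕ} {η : ℝ}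
    (hη : 0 < η) (hn : 1 ≤ n) (hnm : n * m ≤ M) :
    (ArithmeticFunction.vonMangoldt n : ℝ) * ((n * m : ℕ) : ℝ) * ‖a (n * m)‖ ^ 2 ≤
      (1 + η) * M * ((ArithmeticFunction.vonMangoldt n : ℝ) *
          ‖a (n * m) - ((Real.sqrt n : ℂ))⁻¹ * a m‖ ^ 2) +
        (1 + 1 / η) * ((ArithmeticFunction.vonMangoldt n : ℝ) * ((m : ℝ) * ‖a m‖ ^ 2)) := by
  have hn' : (0 : ℝ) < n := by exact_mod_cast hn
  have hnmM : ((n * m : ℕ) : ℝ) ≤ M := by exact_mod_cast hnm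
  have hΛ : 0 ≤ (ArithmeticFunction.vonMangoldt n : ℝ) := ArithmeticFunction.vonMangoldt_nonneg
  have hη1 : (0 : ℝ) ≤ 1 + η := by positivity
  have hy : ‖((Real.sqrt n : ℂ))⁻¹ * a m‖ ^ 2 = ‖a m‖ ^ 2 / n := by
    rw [norm_mul, norm_inv, Complex.norm_real, Real.norm_of_nonneg (Real.sqrt_nonneg _), mul_pow,
      inv_pow, Real.sq_sqrt hn'.le]
    ring
  have hpar := norm_sq_le_eta_mul_norm_sub_sq_add_poincareEta (a (n * m))
    (((Real.sqrt n : ℂ))⁻¹ * a m) hη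
  rw [hy] at hpar
  have hD : 0 ≤ (ArithmeticFunction.vonMangoldt n : ℝ) *
      ‖a (n * m) - ((Real.sqrt n : ℂ))⁻¹ * a m‖ ^ 2 := by positivity
  calc (ArithmeticFunction.vonMangoldt n : ℝ) * ((n * m : ℕ) : ℝ) * ‖a (n * m)‖ ^ 2
      ≤ (ArithmeticFunction.vonMangoldt n : ℝ) * ((n * m : ℕ) : ℝ) *
          ((1 + η) * ‖a (n * m) - ((Real.sqrt n : ℂ))⁻¹ * a m‖ ^ 2 +
            (1 + 1 / η) * (‖a m‖ ^ 2 / n)) :=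
        mul_le_mul_of_nonneg_left hpar (by positivity)
    _ = (1 + η) * ((n * m : ℕ) : ℝ) * ((ArithmeticFunction.vonMangoldt n : ℝ) *
          ‖a (n * m) - ((Real.sqrt n : ℂ))⁻¹ * a m‖ ^ 2) +
        (1 + 1 / η) * ((ArithmeticFunction.vonMangoldt n : ℝ) * ((m : ℝ) * ‖a m‖ ^ 2)) := by
        push_cast
        field_simp
    _ ≤ (1 + η) * M * ((ArithmeticFunction.vonMangoldt n : ℝ) *
          ‖a (n * m) - ((Real.sqrt n : ℂ))⁻¹ * a m‖ ^ 2) +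
        (1 + 1 / η) * ((ArithmeticFunction.vonMangoldt n : ℝ) * ((m : ℝ) * ‖a m‖ ^ 2)) := by
        gcongr

/-- The tree's explicit Chebyshev bound at natural arguments, `ψ(K) = Σ_{1 ≤ n ≤ K} Λ(n) ≤ (23/20) K`:
for `K ≤ 10⁴` from `ψ(x) ≤ 1.04 x` (`SchoenfeldBound.psi_le_of_le_ten_thousand`), for `K ≥ 10⁴` from
`ψ(x) ≤ 1.0722 x + 7 √x` (`psi_le_sylvester`) and `7 √K ≤ 0.07 K`. [folklore] -/
private theorem sum_Icc_vonMangoldt_le_poincareEta (K : ℕ) :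
    ∑ n ∈ Finset.Icc 1 K, (ArithmeticFunction.vonMangoldt n : ℝ) ≤ 23 / 20 * (K : ℝ) := by
  have e : Finset.Icc 1 K = Finset.Ioc 0 K := by
    ext n; simp only [Finset.mem_Icc, Finset.mem_Ioc]; omega
  have hψ : Chebyshev.psi (K : ℝ) = ∑ n ∈ Finset.Icc 1 K, (ArithmeticFunction.vonMangoldt n : ℝ) := by
    rw [Chebyshev.psi, Nat.floor_natCast, e]
  rw [← hψ]
  have hK0 : (0 : ℝ) ≤ K := Nat.cast_nonneg K
  rcases le_or_gt (K : ℝ) 10000 with hK | hK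
  · have h := SchoenfeldBound.psi_le_of_le_ten_thousand hK0 hK
    linarith
  · have h := psi_le_sylvester hK0
    have h100 : (100 : ℝ) ≤ Real.sqrt K := by
      rw [Real.le_sqrt (by norm_num) hK0]
      nlinarith
    have hss : Real.sqrt K * Real.sqrt K = K := Real.mul_self_sqrt hK0
    nlinarith [Real.sqrt_nonneg (K : ℝ), mul_nonneg (Real.sqrt_nonneg (K : ℝ)) (sub_nonneg.2 h100)]

-- adapted from Theorems/WeilCombCombShapePositivityStubPoincareExplicit.lean (free `η`, constant `23/20`)
/-- **Stub — multiscale Poincaré inequality on the von Mangoldt divisor graph, free splitting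
parameter.** For every `η > 0`:
`Σ_{k ≤ M} k log k ‖a_k‖² ≤ (1 + η) M · D(a) + (1 + 1/η)(23/20) · M · ‖a‖²`
(Perron gauge `n^{-1/2}`; Chebyshev `ψ(K) ≤ (23/20) K`). -/
theorem stub_poincareEta : ∀ (M : ℕ) (a : ℕ → ℂ) (η : ℝ), 0 < η →
    ∑ m ∈ Finset.Icc 1 M, (m : ℝ) * Real.log m * ‖a m‖ ^ 2 ≤
      (1 + η) * M * (∑ m ∈ Finset.Icc 1 M, ∑ n ∈ Finset.Icc 1 (M / m),
          (ArithmeticFunction.vonMangoldt n : ℝ) * ‖a (n * m) - ((Real.sqrt n : ℂ))⁻¹ * a m‖ ^ 2) +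
        (1 + 1 / η) * (23 / 20) * M * ∑ m ∈ Finset.Icc 1 M, ‖a m‖ ^ 2 := by
  intro M a η hη
  -- Step 1: `Σ_k k log k ‖a_k‖² = Σ_m Σ_{n ≤ M/m} Λ(n) (nm) ‖a(nm)‖²`.
  have h1 : ∑ m ∈ Finset.Icc 1 M, (m : ℝ) * Real.log m * ‖a m‖ ^ 2 =
      ∑ m ∈ Finset.Icc 1 M, ∑ n ∈ Finset.Icc 1 (M / m),
        (ArithmeticFunction.vonMangoldt n : ℝ) * ((n * m : ℕ) : ℝ) * ‖a (n * m)‖ ^ 2 := by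
    rw [sum_Icc_sum_Icc_div_eq_sum_divisors_poincareEta M
      (fun n m => (ArithmeticFunction.vonMangoldt n : ℝ) * ((n * m : ℕ) : ℝ) * ‖a (n * m)‖ ^ 2)]
    refine Finset.sum_congr rfl fun k _ => ?_
    rw [← ArithmeticFunction.vonMangoldt_sum, Finset.mul_sum, Finset.sum_mul]
    refine Finset.sum_congr rfl fun n hn => ?_
    rw [Nat.mul_div_cancel' (Nat.mem_divisors.1 hn).1]
    ring
  -- Step 2: the edgewise bound, summed over all edges.
  have h2 : ∑ m ∈ Finset.Icc 1 M, ∑ n ∈ Finset.Icc 1 (M / m),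
      (ArithmeticFunction.vonMangoldt n : ℝ) * ((n * m : ℕ) : ℝ) * ‖a (n * m)‖ ^ 2 ≤
      ∑ m ∈ Finset.Icc 1 M, ∑ n ∈ Finset.Icc 1 (M / m),
        ((1 + η) * M * ((ArithmeticFunction.vonMangoldt n : ℝ) *
            ‖a (n * m) - ((Real.sqrt n : ℂ))⁻¹ * a m‖ ^ 2) +
          (1 + 1 / η) * ((ArithmeticFunction.vonMangoldt n : ℝ) * ((m : ℝ) * ‖a m‖ ^ 2))) := by
    refine Finset.sum_le_sum fun m hm => Finset.sum_le_sum fun n hn => ?_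
    have hm1 : 1 ≤ m := (Finset.mem_Icc.1 hm).1
    obtain ⟨hn1, hnM⟩ := Finset.mem_Icc.1 hn
    exact vonMangoldt_mul_mul_norm_sq_le_poincareEta a hη hn1 ((Nat.le_div_iff_mul_le hm1).1 hnM)
  -- Step 3: split the summed bound into `(1+η) M · D(a)` and `(1+1/η) Σ_m m ‖a_m‖² ψ(M/m)`.
  have h3 : ∑ m ∈ Finset.Icc 1 M, ∑ n ∈ Finset.Icc 1 (M / m),
      ((1 + η) * M * ((ArithmeticFunction.vonMangoldt n : ℝ) *
          ‖a (n * m) - ((Real.sqrt n : ℂ))⁻¹ * a m‖ ^ 2) +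
        (1 + 1 / η) * ((ArithmeticFunction.vonMangoldt n : ℝ) * ((m : ℝ) * ‖a m‖ ^ 2))) =
      (1 + η) * M * (∑ m ∈ Finset.Icc 1 M, ∑ n ∈ Finset.Icc 1 (M / m),
          (ArithmeticFunction.vonMangoldt n : ℝ) * ‖a (n * m) - ((Real.sqrt n : ℂ))⁻¹ * a m‖ ^ 2) +
        (1 + 1 / η) * ∑ m ∈ Finset.Icc 1 M, (m : ℝ) * ‖a m‖ ^ 2 *
          ∑ n ∈ Finset.Icc 1 (M / m), (ArithmeticFunction.vonMangoldt n : ℝ) := by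
    rw [Finset.mul_sum, Finset.mul_sum, ← Finset.sum_add_distrib]
    refine Finset.sum_congr rfl fun m _ => ?_
    rw [Finset.sum_add_distrib]
    simp only [Finset.mul_sum]
    congr 1
    refine Finset.sum_congr rfl fun n _ => ?_
    ring
  -- Step 4: Chebyshev, `ψ(M/m) ≤ (23/20) (M/m)` and `m (M/m) ≤ M`.
  have h4 : ∑ m ∈ Finset.Icc 1 M, (m : ℝ) * ‖a m‖ ^ 2 *
      ∑ n ∈ Finset.Icc 1 (M / m), (ArithmeticFunction.vonMangoldt n : ℝ) ≤
      23 / 20 * M * ∑ m ∈ Finset.Icc 1 M, ‖a m‖ ^ 2 := by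
    rw [Finset.mul_sum]
    refine Finset.sum_le_sum fun m _ => ?_
    have hψ := sum_Icc_vonMangoldt_le_poincareEta (M / m)
    have hdiv : (m : ℝ) * ((M / m : ℕ) : ℝ) ≤ M := by exact_mod_cast Nat.mul_div_le M m
    calc (m : ℝ) * ‖a m‖ ^ 2 * ∑ n ∈ Finset.Icc 1 (M / m), (ArithmeticFunction.vonMangoldt n : ℝ)
        ≤ (m : ℝ) * ‖a m‖ ^ 2 * (23 / 20 * ((M / m : ℕ) : ℝ)) :=
          mul_le_mul_of_nonneg_left hψ (by positivity)
      _ = 23 / 20 * ((m : ℝ) * ((M / m : ℕ) : ℝ)) * ‖a m‖ ^ 2 := by ring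
      _ ≤ 23 / 20 * M * ‖a m‖ ^ 2 :=
          mul_le_mul_of_nonneg_right (mul_le_mul_of_nonneg_left hdiv (by norm_num)) (by positivity)
  rw [h1]
  refine h2.trans ?_
  rw [h3]
  have hη' : (0 : ℝ) ≤ 1 + 1 / η := by positivity
  have h5 : (1 + 1 / η) * (23 / 20) * (M : ℝ) * ∑ m ∈ Finset.Icc 1 M, ‖a m‖ ^ 2 =
      (1 + 1 / η) * (23 / 20 * M * ∑ m ∈ Finset.Icc 1 M, ‖a m‖ ^ 2) := by ring
  rw [h5]
  have h6 := mul_le_mul_of_nonneg_left h4 hη'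
  linarith
  
end Summit.RiemannHypothesis.RiemannHypothesis.Theorems.WeilCombBohrFejer

end
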